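import Literature.Probability.LatticeModels.PercolationRowEdgeOperators
import HarnessLib

/-!
# The Temperley–Lieb (`β = 1`) relations of the percolation detach / join generators

Companion to `PercolationRowTransfer.lean` / `PercolationRowEdgeOperators.lean`. The single-bond
operators of the stochastic row transfer matrix of bond percolation on `ℤ²` — `D_x` (detach the
site `x`: one closed vertical bond) and `J_x` (join `x` and `x + 1`: one open horizontal bond) —
satisfy, besides `D_x² = D_x`, `J_x² = J_x` (loc. cit.), the MIXED relations

* `J_x D_x J_x = J_x`, `J_x D_{x+1} J_x = J_x` (`joinRel_detachRel_joinRel`,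
  `joinRel_detachRel_succ_joinRel`),
* `D_x J_x D_x = D_x`, `D_{x+1} J_x D_{x+1} = D_{x+1}` (`detachRel_joinRel_detachRel`,
  `detachRel_succ_joinRel_detachRel_succ`),
* `D_x J_y = J_y D_x` for `x ∉ {y, y + 1}` (`detachRel_joinRel_comm`),

i.e. with `e_{2j-1} ↔ D_{x_j}`, `e_{2j} ↔ J_{x_j}` on a row of consecutive columns, the defining
relations `eᵢ² = (q + q⁻¹) eᵢ`, `eᵢ e_{i±1} eᵢ = eᵢ`, `[eᵢ, eⱼ] = 0 (|i - j| > 1)` of the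
Temperley–Lieb algebra at loop weight `q + q⁻¹ = 1` (Pearce–Rittenberg–de Gier–Nienhuis, *Temperley–
Lieb stochastic processes*, J. Phys. A 35 (2002) L661, §2 (TL): "restricting ourselves to the case
`q = e^{iπ/3}` […] closed contractible loops may be removed at the cost of a factor `q + q⁻¹ = 1`";
its Hamiltonian `H = Σⱼ (1 - eⱼ)` is "closely related to the critical `Q = 1` Potts model"), here in
the cluster / connectivity-state representation of the `Q = 1` Potts model (Blöte–Nightingale 1982;
Bondesan–Jacobsen–Saleur arXiv:1207.7005 §5.1: the loop-model Hamiltonian "acts on link states,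
patterns of connectivities of sites"). The relations hold on ALL set partitions of the row points
(not only on planar ones) and are proved from the pointwise descriptions `detachRel_apply`,
`joinRel_apply`. State-level versions: `RowState.join_detach_join`, `RowState.detach_join_detach`, ….

Not here: the abstract algebra / the packaging as an `IsTemperleyLiebFamily` indexed by `Fin (2n-1)`
for a row of `n` consecutive columns (index bookkeeping only).
-/

noncomputable section

open Finset
open scoped Classical

namespace Literature.Probability.LatticeModels

variable {S : Finset ℤ}

/-! ### The mixed Temperley–Lieb relations (`β = 1`)

With `u = x`, `v = x + 1` the generators `D_x` (detach) and `J_x` (join) satisfy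
`J_x D_u J_x = J_x`, `J_x D_v J_x = J_x`, `D_u J_x D_u = D_u`, `D_v J_x D_v = D_v`, and far-apart
generators commute: the relations `eᵢ e_{i±1} eᵢ = eᵢ`, `[eᵢ, eⱼ] = 0` of the Temperley–Lieb algebra
at loop weight `eᵢ² = 1 · eᵢ` in the cluster (connectivity) representation `e_{2j-1} ↔ D_j`,
`e_{2j} ↔ J_j` (Pearce–Rittenberg–de Gier–Nienhuis 2002, §2 (TL); Blöte–Nightingale 1982). -/

/-- Auxiliary form of `J D J = J`: the detached site `p` is either endpoint of the edge. [folklore] -/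
private theorem joinRel_detachRel_joinRel_aux (x : S) (p q : S)
    (hpq : p ≠ q) (hedge : ∀ ρ : Setoid (RowPoint S), joinRel x ρ (Sum.inl p) (Sum.inl q))
    (π : Setoid (RowPoint S)) :
    joinRel x (detachRel p (joinRel x π)) = joinRel x π := by
  apply le_antisymm
  · exact sup_le ((vertRel_le _ _).trans le_rfl) le_sup_right
  · refine sup_le ?_ le_sup_right
    intro a b hab
    set τ := joinRel x (detachRel p (joinRel x π))
    -- from `p`, go through the other endpoint `q`
    have key : ∀ c, c ≠ Sum.inl p → π (Sum.inl p) c → τ (Sum.inl p) c := by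
      intro c hc hpc
      refine τ.trans' (hedge _) (le_joinRel x _ ?_)
      rw [detachRel_apply]
      refine Or.inr ⟨fun e => hpq.symm (Sum.inl_injective e), hc, ?_⟩
      exact (joinRel x π).trans' ((joinRel x π).symm' (hedge π)) (le_joinRel x π hpc)
    by_cases ha : a = Sum.inl p
    · subst ha
      by_cases hb : b = Sum.inl p
      · subst hb
        exact τ.refl _
      · exact key b hb hab
    · by_cases hb : b = Sum.inl p
      · subst hb
        exact τ.symm' (key a ha (π.symm' hab))
      · exact le_joinRel x _ ((detachRel_apply _ _ _ _).2 (Or.inr ⟨ha, hb, le_joinRel x π hab⟩))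

/-- **`J_x D_x J_x = J_x`** (`e_{2j} e_{2j-1} e_{2j} = e_{2j}`). [cite: PearceRittenbergDeGierNienhuis2002, §2 (TL)] -/
theorem joinRel_detachRel_joinRel (x : S) (h : (x : ℤ) + 1 ∈ S) (π : Setoid (RowPoint S)) :
    joinRel x (detachRel x (joinRel x π)) = joinRel x π :=
  joinRel_detachRel_joinRel_aux x x ⟨(x : ℤ) + 1, h⟩ (ne_hEdgeSucc x h)
    (fun ρ => joinRel_rel x h ρ) π

/-- **`J_x D_{x+1} J_x = J_x`** (`e_{2j} e_{2j+1} e_{2j} = e_{2j}`). [cite: PearceRittenbergDeGierNienhuis2002, §2 (TL)] -/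
theorem joinRel_detachRel_succ_joinRel (x : S) (h : (x : ℤ) + 1 ∈ S) (π : Setoid (RowPoint S)) :
    joinRel x (detachRel ⟨(x : ℤ) + 1, h⟩ (joinRel x π)) = joinRel x π :=
  joinRel_detachRel_joinRel_aux x ⟨(x : ℤ) + 1, h⟩ x (ne_hEdgeSucc x h).symm
    (fun ρ => (joinRel x ρ).symm' (joinRel_rel x h ρ)) π

/-- Auxiliary form of `D J D = D`: the detached site `p` is either endpoint of the edge. [folklore] -/
private theorem detachRel_joinRel_detachRel_aux (x : S) (h : (x : ℤ) + 1 ∈ S) (p q : S)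
    (hpq : (p = x ∧ q = ⟨(x : ℤ) + 1, h⟩) ∨ (p = ⟨(x : ℤ) + 1, h⟩ ∧ q = x))
    (π : Setoid (RowPoint S)) :
    detachRel p (joinRel x (detachRel p π)) = detachRel p π := by
  apply le_antisymm
  · intro a b hab
    rw [detachRel_apply] at hab
    rcases hab with rfl | ⟨ha, hb, hab⟩
    · exact (detachRel p π).refl _
    rw [joinRel_apply x h] at hab
    -- membership in the merged class reduces to being joined to `q`
    have hq : ∀ c, c ≠ Sum.inl p →
        (detachRel p π c (Sum.inl x) ∨ detachRel p π c (Sum.inl ⟨(x : ℤ) + 1, h⟩)) →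
        detachRel p π c (Sum.inl q) := by
      intro c hc hc'
      rcases hpq with ⟨rfl, rfl⟩ | ⟨rfl, rfl⟩
      · rcases hc' with hc' | hc'
        · exact absurd ((detachRel_rel_inl_iff _ π c).1 hc') hc
        · exact hc'
      · rcases hc' with hc' | hc'
        · exact hc'
        · exact absurd ((detachRel_rel_inl_iff _ π c).1 hc') hc
    rcases hab with hab | ⟨ha', hb'⟩
    · exact hab
    · exact (detachRel p π).trans' (hq a ha ha') ((detachRel p π).symm' (hq b hb hb'))
  · calc detachRel p π = detachRel p (detachRel p π) := (detachRel_detachRel p π).symm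
      _ ≤ detachRel p (joinRel x (detachRel p π)) := vertRel_mono _ (le_joinRel x _)

/-- **`D_x J_x D_x = D_x`** (`e_{2j-1} e_{2j} e_{2j-1} = e_{2j-1}`); trivially true also when
`x + 1` is not a column. [cite: PearceRittenbergDeGierNienhuis2002, §2 (TL)] -/
theorem detachRel_joinRel_detachRel (x : S) (π : Setoid (RowPoint S)) :
    detachRel x (joinRel x (detachRel x π)) = detachRel x π := by
  by_cases h : (x : ℤ) + 1 ∈ S
  · exact detachRel_joinRel_detachRel_aux x h x _ (Or.inl ⟨rfl, rfl⟩) π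
  · rw [joinRel_of_not_mem x h, detachRel_detachRel]

/-- **`D_{x+1} J_x D_{x+1} = D_{x+1}`** (`e_{2j+1} e_{2j} e_{2j+1} = e_{2j+1}`).
[cite: PearceRittenbergDeGierNienhuis2002, §2 (TL)] -/
theorem detachRel_succ_joinRel_detachRel_succ (x : S) (h : (x : ℤ) + 1 ∈ S)
    (π : Setoid (RowPoint S)) :
    detachRel ⟨(x : ℤ) + 1, h⟩ (joinRel x (detachRel ⟨(x : ℤ) + 1, h⟩ π)) =
      detachRel ⟨(x : ℤ) + 1, h⟩ π :=
  detachRel_joinRel_detachRel_aux x h _ x (Or.inr ⟨rfl, rfl⟩) π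

/-- **Far commutation `D_x J_y = J_y D_x`** for `x ∉ {y, y + 1}`. [cite: PearceRittenbergDeGierNienhuis2002, §2 (TL)] -/
theorem detachRel_joinRel_comm (x y : S) (hxy : x ≠ y) (hxy' : (x : ℤ) ≠ y + 1)
    (π : Setoid (RowPoint S)) :
    detachRel x (joinRel y π) = joinRel y (detachRel x π) := by
  by_cases h : (y : ℤ) + 1 ∈ S
  swap
  · rw [joinRel_of_not_mem y h, joinRel_of_not_mem y h]
  have hu : (Sum.inl y : RowPoint S) ≠ Sum.inl x := fun e => hxy (Sum.inl_injective e).symm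
  have hv : (Sum.inl ⟨(y : ℤ) + 1, h⟩ : RowPoint S) ≠ Sum.inl x := by
    intro e
    exact hxy' (congrArg Subtype.val (Sum.inl_injective e)).symm
  apply le_antisymm
  · intro a b hab
    rw [detachRel_apply, joinRel_apply y h] at hab
    rw [joinRel_apply y h, detachRel_apply, detachRel_apply, detachRel_apply, detachRel_apply,
      detachRel_apply]
    rcases hab with rfl | ⟨ha, hb, hab | ⟨ha', hb'⟩⟩
    · exact Or.inl (Or.inl rfl)
    · exact Or.inl (Or.inr ⟨ha, hb, hab⟩)
    · refine Or.inr ⟨?_, ?_⟩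
      · exact ha'.imp (fun k => Or.inr ⟨ha, hu, k⟩) (fun k => Or.inr ⟨ha, hv, k⟩)
      · exact hb'.imp (fun k => Or.inr ⟨hb, hu, k⟩) (fun k => Or.inr ⟨hb, hv, k⟩)
  · refine sup_le (vertRel_mono _ (le_joinRel y π)) ?_
    rw [hEdgeRel_of_mem y h, joinTwo_le_iff, detachRel_apply]
    exact Or.inr ⟨hu, hv, joinRel_rel y h π⟩

namespace RowState

/-- `J_x D_x J_x = J_x`. [cite: PearceRittenbergDeGierNienhuis2002, §2 (TL)] -/
theorem join_detach_join (x : S) (h : (x : ℤ) + 1 ∈ S) (π : RowState S) :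
    join x (detach x (join x π)) = join x π :=
  RowState.ext (joinRel_detachRel_joinRel x h π.rel)

/-- `J_x D_{x+1} J_x = J_x`. [cite: PearceRittenbergDeGierNienhuis2002, §2 (TL)] -/
theorem join_detach_succ_join (x : S) (h : (x : ℤ) + 1 ∈ S) (π : RowState S) :
    join x (detach ⟨(x : ℤ) + 1, h⟩ (join x π)) = join x π :=
  RowState.ext (joinRel_detachRel_succ_joinRel x h π.rel)

/-- `D_x J_x D_x = D_x`. [cite: PearceRittenbergDeGierNienhuis2002, §2 (TL)] -/
theorem detach_join_detach (x : S) (π : RowState S) :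
    detach x (join x (detach x π)) = detach x π :=
  RowState.ext (detachRel_joinRel_detachRel x π.rel)

/-- `D_{x+1} J_x D_{x+1} = D_{x+1}`. [cite: PearceRittenbergDeGierNienhuis2002, §2 (TL)] -/
theorem detach_succ_join_detach_succ (x : S) (h : (x : ℤ) + 1 ∈ S) (π : RowState S) :
    detach ⟨(x : ℤ) + 1, h⟩ (join x (detach ⟨(x : ℤ) + 1, h⟩ π)) = detach ⟨(x : ℤ) + 1, h⟩ π :=
  RowState.ext (detachRel_succ_joinRel_detachRel_succ x h π.rel)

/-- `D_x J_y = J_y D_x` for `x ∉ {y, y + 1}`. [cite: PearceRittenbergDeGierNienhuis2002, §2 (TL)] -/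
theorem detach_join_comm (x y : S) (hxy : x ≠ y) (hxy' : (x : ℤ) ≠ y + 1) (π : RowState S) :
    detach x (join y π) = join y (detach x π) :=
  RowState.ext (detachRel_joinRel_comm x y hxy hxy' π.rel)

end RowState

end Literature.Probability.LatticeModels

end
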